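import Literature.IUT.LogVolume.GenuineLogThetaExactVolume
import HarnessLib

/-!
# The EXACT value of the genuine `−|log(Θ)|` of a Θ-volume input, and [IUTchIII] Cor. 3.12 for the input as an
# explicit inequality in finitely many content integers (Dupuy–Hilado §1 (1.1), §4.12; [IUTchIII] Cor. 3.12)

Record/proof-only file of the abc-iut cell (Cor. 3.12 crew, L-DH lane, seat abc-iut-c312-3; item «XXVIIc-DH» of
`HOME/skel/FORK-INDEX.md` row 2, DH-GLOBAL column — input level; sequel to `GenuineLogThetaExactVolume.lean`).
TAKES NO SIDE on [IUTchIII] Cor. 3.12.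

For a GENUINE Θ-volume input `I : ThetaVolumeInput F₀ K` (`GenuineLogTheta.lean`; any `F₀`, any number of places
over `p`; packets `realPrimePacketM` over the genuine completions `K_{v̲}`), summing the packet-level exact formula
over the support primes `T(I)`:

* **`ThetaVolumeInput.negLogThetaNonarch_eq_of_content`** — for any family `m(p,i,v⃗)` of contents of the slot unions
  `⋃_a ι_a(t_{Θ,i,v_a})·(R_I)^∼` (w.r.t. `log_p(R_{v⃗}^×)`),
  `negLogThetaNonarch I = Σ_{p∈T(I)} (1/ℓ⋇)·Σ_{i<ℓ⋇} Σ_{v⃗∈𝕍_p^{i+2}} (−m(p,i,v⃗)·log p + log μ̄(hull(log_p(R_{v⃗}^×))))·Π_b Pr(v_b)`;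
* `exists_contentFamily` — such a family exists (it is unique prime by prime: `slotUnion_contentFamily_unique`);
* **`cor312NonarchOf_iff_of_content`** / **`cor312Of_iff_of_content`** — Dupuy–Hilado's (1.1) resp. [IUTchIII]
  Cor. 3.12 for the input (sharp reading; the forms the summit-side `DHData.Cor312DH (ofInput I)` and the route's
  `Cor22.cor312AtDatum` transcribe) ARE the explicit inequality
  `−deĝ̲(P_q) ≤ Σ_{p∈T(I)} (1/ℓ⋇) Σ_i Σ_{v⃗} (−m(p,i,v⃗)·log p + κ(v⃗))·Π Pr  [+ ((l+5)/4)·log π]`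
  between the `q`-pilot degree and finitely many lattice contents `m(p,i,v⃗) ∈ ℤ` (`κ(v⃗) = log μ̄(hull(log_p(R_{v⃗}^×)))`,
  a constant of the completions) — the «Statement ⟺ an explicit Szpiro-shape inequality, curve by curve, no slack
  either way» of `HOME/skel/FORK-REAL-MODEL.md` §4, as a kernel `iff` AT THE GENUINE DATUM. Necessary direction in
  degrees: `LDHGenuine.gap_le_of_cor312Of` ([IUTchIV] Thm. 1.10); the content windows: abc-iut-w5-d082's
  `TensorPacketContentBounds`.

[cite: DupuyHilado2025, §1 (1.1), Def. 3.6.3, §4.12] [cite: Mochizuki2012, IUTchIII Cor. 3.12 p. 173–174]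
[cite: Mochizuki2012, IUTchIV Thm. 1.10 Step (vii)–(viii) p. 30–31] [cite: WeilBNT1967, Ch. II §2, Th. 2]
[claim: Mochizuki2012, status: disputed] HONEST SCOPE: nothing asserts `Cor312Of`/`Cor312NonarchOf` for any input —
both sides of each `iff` are HYPOTHESIS-shaped; (Ind2)/the hull are the tree's typings of disputed-corpus
constructions. PROOF-ONLY file: no definitions, no named `Prop` facts; typed ≠ proved.
-/

noncomputable section

open Set Module
open scoped Pointwise TensorProduct

namespace Literature.IUT.LogVolume

/-! ## Input level: the genuine `−|log(Θ)|` of a Θ-volume input -/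

namespace ThetaVolumeInput

variable {F₀ : Type} [Field F₀] [NumberField F₀] {K : Type} [Field K] [NumberField K] [Algebra F₀ K]
variable (I : ThetaVolumeInput F₀ K)

/-- **The local summand of `−|log(Θ)|` at a prime `p` in terms of contents**: for any content family `m(i,v⃗)` of
the slot unions of the Θ-idele of `I` at `p`,
`negLogThetaLoc I p = (1/ℓ⋇)·Σ_i Σ_{v⃗} (−m(i,v⃗)·log p + log μ̄(hull(log_p(R_{v⃗}^×))))·Π_b Pr(v_b)`.
[cite: DupuyHilado2025, Def. 3.6.3, §4.12] -/
theorem negLogThetaLoc_eq_of_content (p : ℕ) [hp : Fact p.Prime]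
    (m : (i : Fin I.lstar) → (Fin ((i : ℕ) + 1 + 1) → placesOver F₀ p) → ℤ)
    (hm : ∀ (i : Fin I.lstar) (e : Fin ((i : ℕ) + 1 + 1) → placesOver F₀ p),
      (⋃ a : Fin ((i : ℕ) + 1 + 1), iota p (fun b => (I.σ.localFieldFamily p hp.out).k (e b)) a
            (I.tΘ p hp.out i (e a) : (I.σ.localFieldFamily p hp.out).k (e a)) •
          (normalizedPacket p (fun b => (I.σ.localFieldFamily p hp.out).k (e b)) :
            Set (PacketAlgebra p (fun b => (I.σ.localFieldFamily p hp.out).k (e b))))) ⊆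
        ((p : ℚ_[p]) ^ m i e) • (logPacket p (fun b => (I.σ.localFieldFamily p hp.out).k (e b)) :
            Set (PacketAlgebra p (fun b => (I.σ.localFieldFamily p hp.out).k (e b)))) ∧
      ¬ (⋃ a : Fin ((i : ℕ) + 1 + 1), iota p (fun b => (I.σ.localFieldFamily p hp.out).k (e b)) a
            (I.tΘ p hp.out i (e a) : (I.σ.localFieldFamily p hp.out).k (e a)) •
          (normalizedPacket p (fun b => (I.σ.localFieldFamily p hp.out).k (e b)) :
            Set (PacketAlgebra p (fun b => (I.σ.localFieldFamily p hp.out).k (e b))))) ⊆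
        ((p : ℚ_[p]) ^ (m i e + 1)) • (logPacket p (fun b => (I.σ.localFieldFamily p hp.out).k (e b)) :
            Set (PacketAlgebra p (fun b => (I.σ.localFieldFamily p hp.out).k (e b))))) :
    I.negLogThetaLoc p =
      (1 / (I.lstar : ℝ)) * ∑ i : Fin I.lstar, ∑ e : Fin ((i : ℕ) + 1 + 1) → placesOver F₀ p,
        (-(m i e * Real.log p) + packetLogμ p (fun b => (I.σ.localFieldFamily p hp.out).k (e b))
          (packetHull p (fun b => (I.σ.localFieldFamily p hp.out).k (e b))
            (logPacket p (fun b => (I.σ.localFieldFamily p hp.out).k (e b)) :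
              Set (PacketAlgebra p (fun b => (I.σ.localFieldFamily p hp.out).k (e b)))))) *
          ∏ b, weight F₀ (e b).1 := by
  rw [I.negLogThetaLoc_of_prime hp.out]
  exact realPrimePacketWith_negLogThetaAt_eq_of_content p (I.σ.localFieldFamily p hp.out)
    (mScale p (I.σ.localFieldFamily p hp.out)) (mScale_ne_zero p (I.σ.localFieldFamily p hp.out))
    (mScale_perm p (I.σ.localFieldFamily p hp.out)) (I.tΘ p hp.out) m hm

/-- **THE GENUINE `−|log(Θ)|` (nonarchimedean part) IS AN AFFINE FUNCTION OF THE CONTENTS**: for any family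
`m(p,i,v⃗)` giving, at every support prime `p`, the contents of the slot unions of the Θ-idele,
`negLogThetaNonarch I = Σ_{p ∈ T(I)} (1/ℓ⋇)·Σ_i Σ_{v⃗ ∈ 𝕍_p^{i+2}} (−m(p,i,v⃗)·log p + log μ̄(hull(log_p(R_{v⃗}^×))))·Π_b Pr(v_b)`.
[cite: DupuyHilado2025, §1 (1.1), Def. 3.6.3, §4.12] -/
theorem negLogThetaNonarch_eq_of_content
    (m : (p : ℕ) → (i : Fin I.lstar) → (Fin ((i : ℕ) + 1 + 1) → placesOver F₀ p) → ℤ)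
    (hm : ∀ (p : ℕ) [hp : Fact p.Prime], p ∈ I.supportPrimes →
      ∀ (i : Fin I.lstar) (e : Fin ((i : ℕ) + 1 + 1) → placesOver F₀ p),
      (⋃ a : Fin ((i : ℕ) + 1 + 1), iota p (fun b => (I.σ.localFieldFamily p hp.out).k (e b)) a
            (I.tΘ p hp.out i (e a) : (I.σ.localFieldFamily p hp.out).k (e a)) •
          (normalizedPacket p (fun b => (I.σ.localFieldFamily p hp.out).k (e b)) :
            Set (PacketAlgebra p (fun b => (I.σ.localFieldFamily p hp.out).k (e b))))) ⊆
        ((p : ℚ_[p]) ^ m p i e) • (logPacket p (fun b => (I.σ.localFieldFamily p hp.out).k (e b)) :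
            Set (PacketAlgebra p (fun b => (I.σ.localFieldFamily p hp.out).k (e b)))) ∧
      ¬ (⋃ a : Fin ((i : ℕ) + 1 + 1), iota p (fun b => (I.σ.localFieldFamily p hp.out).k (e b)) a
            (I.tΘ p hp.out i (e a) : (I.σ.localFieldFamily p hp.out).k (e a)) •
          (normalizedPacket p (fun b => (I.σ.localFieldFamily p hp.out).k (e b)) :
            Set (PacketAlgebra p (fun b => (I.σ.localFieldFamily p hp.out).k (e b))))) ⊆
        ((p : ℚ_[p]) ^ (m p i e + 1)) • (logPacket p (fun b => (I.σ.localFieldFamily p hp.out).k (e b)) :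
            Set (PacketAlgebra p (fun b => (I.σ.localFieldFamily p hp.out).k (e b))))) :
    I.negLogThetaNonarch = ∑ p ∈ I.supportPrimes,
      (1 / (I.lstar : ℝ)) * ∑ i : Fin I.lstar, ∑ e : Fin ((i : ℕ) + 1 + 1) → placesOver F₀ p,
        (if hp : p.Prime then
          haveI : Fact p.Prime := ⟨hp⟩
          (-(m p i e * Real.log p) + packetLogμ p (fun b => (I.σ.localFieldFamily p hp).k (e b))
            (packetHull p (fun b => (I.σ.localFieldFamily p hp).k (e b))
              (logPacket p (fun b => (I.σ.localFieldFamily p hp).k (e b)) :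
                Set (PacketAlgebra p (fun b => (I.σ.localFieldFamily p hp).k (e b)))))) *
            ∏ b, weight F₀ (e b).1
          else 0) := by
  unfold negLogThetaNonarch
  refine Finset.sum_congr rfl fun p hpT => ?_
  have hp : p.Prime := I.prime_of_mem_supportPrimes hpT
  haveI : Fact p.Prime := ⟨hp⟩
  rw [I.negLogThetaLoc_eq_of_content p (m p) (hm p hpT)]
  refine congrArg (fun x : ℝ => (1 / (I.lstar : ℝ)) * x) (Finset.sum_congr rfl fun i _ => ?_)
  refine Finset.sum_congr rfl fun e _ => ?_
  rw [dif_pos hp]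

/-- **A content family EXISTS for every genuine input** (contents of the slot unions at every support prime;
the value at a non-prime index is irrelevant and set to `0`). [cite: WeilBNT1967, Ch. II §2, Th. 2] -/
theorem exists_contentFamily :
    ∃ m : (p : ℕ) → (i : Fin I.lstar) → (Fin ((i : ℕ) + 1 + 1) → placesOver F₀ p) → ℤ,
      ∀ (p : ℕ) [hp : Fact p.Prime], p ∈ I.supportPrimes →
      ∀ (i : Fin I.lstar) (e : Fin ((i : ℕ) + 1 + 1) → placesOver F₀ p),
      (⋃ a : Fin ((i : ℕ) + 1 + 1), iota p (fun b => (I.σ.localFieldFamily p hp.out).k (e b)) a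
            (I.tΘ p hp.out i (e a) : (I.σ.localFieldFamily p hp.out).k (e a)) •
          (normalizedPacket p (fun b => (I.σ.localFieldFamily p hp.out).k (e b)) :
            Set (PacketAlgebra p (fun b => (I.σ.localFieldFamily p hp.out).k (e b))))) ⊆
        ((p : ℚ_[p]) ^ m p i e) • (logPacket p (fun b => (I.σ.localFieldFamily p hp.out).k (e b)) :
            Set (PacketAlgebra p (fun b => (I.σ.localFieldFamily p hp.out).k (e b)))) ∧
      ¬ (⋃ a : Fin ((i : ℕ) + 1 + 1), iota p (fun b => (I.σ.localFieldFamily p hp.out).k (e b)) a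
            (I.tΘ p hp.out i (e a) : (I.σ.localFieldFamily p hp.out).k (e a)) •
          (normalizedPacket p (fun b => (I.σ.localFieldFamily p hp.out).k (e b)) :
            Set (PacketAlgebra p (fun b => (I.σ.localFieldFamily p hp.out).k (e b))))) ⊆
        ((p : ℚ_[p]) ^ (m p i e + 1)) • (logPacket p (fun b => (I.σ.localFieldFamily p hp.out).k (e b)) :
            Set (PacketAlgebra p (fun b => (I.σ.localFieldFamily p hp.out).k (e b)))) := by
  classical
  have h : ∀ (p : ℕ) (hp : p.Prime), ∃ m : (i : Fin I.lstar) → (Fin ((i : ℕ) + 1 + 1) → placesOver F₀ p) → ℤ,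
      ∀ (i : Fin I.lstar) (e : Fin ((i : ℕ) + 1 + 1) → placesOver F₀ p),
      haveI : Fact p.Prime := ⟨hp⟩
      (⋃ a : Fin ((i : ℕ) + 1 + 1), iota p (fun b => (I.σ.localFieldFamily p hp).k (e b)) a
            (I.tΘ p hp i (e a) : (I.σ.localFieldFamily p hp).k (e a)) •
          (normalizedPacket p (fun b => (I.σ.localFieldFamily p hp).k (e b)) :
            Set (PacketAlgebra p (fun b => (I.σ.localFieldFamily p hp).k (e b))))) ⊆
        ((p : ℚ_[p]) ^ m i e) • (logPacket p (fun b => (I.σ.localFieldFamily p hp).k (e b)) :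
            Set (PacketAlgebra p (fun b => (I.σ.localFieldFamily p hp).k (e b)))) ∧
      ¬ (⋃ a : Fin ((i : ℕ) + 1 + 1), iota p (fun b => (I.σ.localFieldFamily p hp).k (e b)) a
            (I.tΘ p hp i (e a) : (I.σ.localFieldFamily p hp).k (e a)) •
          (normalizedPacket p (fun b => (I.σ.localFieldFamily p hp).k (e b)) :
            Set (PacketAlgebra p (fun b => (I.σ.localFieldFamily p hp).k (e b))))) ⊆
        ((p : ℚ_[p]) ^ (m i e + 1)) • (logPacket p (fun b => (I.σ.localFieldFamily p hp).k (e b)) :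
            Set (PacketAlgebra p (fun b => (I.σ.localFieldFamily p hp).k (e b)))) := by
    intro p hp
    haveI : Fact p.Prime := ⟨hp⟩
    exact exists_slotUnion_contentFamily p (I.σ.localFieldFamily p hp) (I.tΘ p hp)
  refine ⟨fun p => if hp : p.Prime then (h p hp).choose else fun _ _ => 0, ?_⟩
  intro p hp hpT i e
  have hp' : p.Prime := hp.out
  have hspec := (h p hp').choose_spec i e
  simp only [dif_pos hp']
  exact hspec

/-- **Dupuy–Hilado's (1.1) for a genuine input ⟺ an explicit inequality between `−deĝ̲(P_q)` and the contents**: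
for any content family `m`, `Cor312NonarchOf I ↔ −deĝ̲(P_q) ≤ Σ_{p∈T(I)} (1/ℓ⋇) Σ_i Σ_{v⃗} (−m·log p + κ(v⃗))·Π Pr`
(`κ(v⃗) = log μ̄(hull(log_p(R_{v⃗}^×)))`, a constant of the completions). HYPOTHESIS-shaped on both sides; nothing
asserted. [claim: Mochizuki2012, status: disputed] [cite: DupuyHilado2025, §1 (1.1)] -/
theorem cor312NonarchOf_iff_of_content
    (m : (p : ℕ) → (i : Fin I.lstar) → (Fin ((i : ℕ) + 1 + 1) → placesOver F₀ p) → ℤ)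
    (hm : ∀ (p : ℕ) [hp : Fact p.Prime], p ∈ I.supportPrimes →
      ∀ (i : Fin I.lstar) (e : Fin ((i : ℕ) + 1 + 1) → placesOver F₀ p),
      (⋃ a : Fin ((i : ℕ) + 1 + 1), iota p (fun b => (I.σ.localFieldFamily p hp.out).k (e b)) a
            (I.tΘ p hp.out i (e a) : (I.σ.localFieldFamily p hp.out).k (e a)) •
          (normalizedPacket p (fun b => (I.σ.localFieldFamily p hp.out).k (e b)) :
            Set (PacketAlgebra p (fun b => (I.σ.localFieldFamily p hp.out).k (e b))))) ⊆
        ((p : ℚ_[p]) ^ m p i e) • (logPacket p (fun b => (I.σ.localFieldFamily p hp.out).k (e b)) :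
            Set (PacketAlgebra p (fun b => (I.σ.localFieldFamily p hp.out).k (e b)))) ∧
      ¬ (⋃ a : Fin ((i : ℕ) + 1 + 1), iota p (fun b => (I.σ.localFieldFamily p hp.out).k (e b)) a
            (I.tΘ p hp.out i (e a) : (I.σ.localFieldFamily p hp.out).k (e a)) •
          (normalizedPacket p (fun b => (I.σ.localFieldFamily p hp.out).k (e b)) :
            Set (PacketAlgebra p (fun b => (I.σ.localFieldFamily p hp.out).k (e b))))) ⊆
        ((p : ℚ_[p]) ^ (m p i e + 1)) • (logPacket p (fun b => (I.σ.localFieldFamily p hp.out).k (e b)) :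
            Set (PacketAlgebra p (fun b => (I.σ.localFieldFamily p hp.out).k (e b))))) :
    I.Cor312NonarchOf ↔ -FinDivisor.ndeg F₀ I.X.qPilot ≤ ∑ p ∈ I.supportPrimes,
      (1 / (I.lstar : ℝ)) * ∑ i : Fin I.lstar, ∑ e : Fin ((i : ℕ) + 1 + 1) → placesOver F₀ p,
        (if hp : p.Prime then
          haveI : Fact p.Prime := ⟨hp⟩
          (-(m p i e * Real.log p) + packetLogμ p (fun b => (I.σ.localFieldFamily p hp).k (e b))
            (packetHull p (fun b => (I.σ.localFieldFamily p hp).k (e b))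
              (logPacket p (fun b => (I.σ.localFieldFamily p hp).k (e b)) :
                Set (PacketAlgebra p (fun b => (I.σ.localFieldFamily p hp).k (e b)))))) *
            ∏ b, weight F₀ (e b).1
          else 0) := by
  unfold Cor312NonarchOf negAbsLogQ
  rw [I.negLogThetaNonarch_eq_of_content m hm]

/-- **[IUTchIII] Cor. 3.12 for a genuine input ⟺ the explicit content inequality plus the archimedean term**:
`Cor312Of I ↔ −deĝ̲(P_q) ≤ Σ_{p∈T(I)} (1/ℓ⋇) Σ_i Σ_{v⃗} (−m·log p + κ(v⃗))·Π Pr + ((l+5)/4)·log π`. The sharp-model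
form of «Statement ⟺ an explicit Szpiro-shape inequality, curve by curve» (`HOME/skel/FORK-REAL-MODEL.md` §4) as a
kernel `iff`; HYPOTHESIS-shaped on both sides, nothing asserted. [claim: Mochizuki2012, status: disputed]
[cite: Mochizuki2012, IUTchIII Cor. 3.12 p. 173–174] [cite: Mochizuki2012, IUTchIV Thm. 1.10 Step (vii) p. 30] -/
theorem cor312Of_iff_of_content
    (m : (p : ℕ) → (i : Fin I.lstar) → (Fin ((i : ℕ) + 1 + 1) → placesOver F₀ p) → ℤ)
    (hm : ∀ (p : ℕ) [hp : Fact p.Prime], p ∈ I.supportPrimes →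
      ∀ (i : Fin I.lstar) (e : Fin ((i : ℕ) + 1 + 1) → placesOver F₀ p),
      (⋃ a : Fin ((i : ℕ) + 1 + 1), iota p (fun b => (I.σ.localFieldFamily p hp.out).k (e b)) a
            (I.tΘ p hp.out i (e a) : (I.σ.localFieldFamily p hp.out).k (e a)) •
          (normalizedPacket p (fun b => (I.σ.localFieldFamily p hp.out).k (e b)) :
            Set (PacketAlgebra p (fun b => (I.σ.localFieldFamily p hp.out).k (e b))))) ⊆
        ((p : ℚ_[p]) ^ m p i e) • (logPacket p (fun b => (I.σ.localFieldFamily p hp.out).k (e b)) :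
            Set (PacketAlgebra p (fun b => (I.σ.localFieldFamily p hp.out).k (e b)))) ∧
      ¬ (⋃ a : Fin ((i : ℕ) + 1 + 1), iota p (fun b => (I.σ.localFieldFamily p hp.out).k (e b)) a
            (I.tΘ p hp.out i (e a) : (I.σ.localFieldFamily p hp.out).k (e a)) •
          (normalizedPacket p (fun b => (I.σ.localFieldFamily p hp.out).k (e b)) :
            Set (PacketAlgebra p (fun b => (I.σ.localFieldFamily p hp.out).k (e b))))) ⊆
        ((p : ℚ_[p]) ^ (m p i e + 1)) • (logPacket p (fun b => (I.σ.localFieldFamily p hp.out).k (e b)) :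
            Set (PacketAlgebra p (fun b => (I.σ.localFieldFamily p hp.out).k (e b))))) :
    I.Cor312Of ↔ -FinDivisor.ndeg F₀ I.X.qPilot ≤ (∑ p ∈ I.supportPrimes,
      (1 / (I.lstar : ℝ)) * ∑ i : Fin I.lstar, ∑ e : Fin ((i : ℕ) + 1 + 1) → placesOver F₀ p,
        (if hp : p.Prime then
          haveI : Fact p.Prime := ⟨hp⟩
          (-(m p i e * Real.log p) + packetLogμ p (fun b => (I.σ.localFieldFamily p hp).k (e b))
            (packetHull p (fun b => (I.σ.localFieldFamily p hp).k (e b))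
              (logPacket p (fun b => (I.σ.localFieldFamily p hp).k (e b)) :
                Set (PacketAlgebra p (fun b => (I.σ.localFieldFamily p hp).k (e b)))))) *
            ∏ b, weight F₀ (e b).1
          else 0)) + archLogTheta I.l := by
  unfold Cor312Of negLogTheta negAbsLogQ
  rw [I.negLogThetaNonarch_eq_of_content m hm]

end ThetaVolumeInput

end Literature.IUT.LogVolume

end
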